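import Summits.CriticalPhenomena.PercolationContinuityZ3.Theorems.PercNearOneGluingNoHeavyLowerTailFrontierDecRowsTypedBHK3
import Summits.CriticalPhenomena.PercolationContinuityZ3.Theorems.PercNearOneGluingNoHeavyLowerTailFrontierDecRowsClusterBHK3Defs
import HarnessLib

/-!
# Six of the seven open four-point dec orbits follow from the named conjecture `ClusterBHK3Pos` (G⁺)

Support file (prover prim-ineq-prove-3 gen 10 cycle 1; `--supports stmt-CriticalPhenomena-4575`).  No definitions, no sorries, no
`native_decide`; CONDITIONAL on the named conjecture `FrontierDecRows.ClusterBHK3Pos` (`…FrontierDecRowsClusterBHK3Defs`, tagged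
`@[conjecture]` — an obligation node, not a fact).

Composition of `frontier_{15,36,44}_of_clusterBHK3` (`…FrontierDecRowsTypedBHK3`, corrected cluster-monotone typing) with
`frontier_12_27_30_all_of_frontier_44_all` (`…FrontierDecRowsLiteralDropping`): under `ClusterBHK3Pos` the open rows 12, 15, 27, 30,
36 (PATH) and 44 of `…FrontierDecRowsLeFive` hold on every finite weighted graph; the only open dec orbit NOT covered is row 37
`(D[ab|c], D[ac|y], D[ay|b])`.

* `frontier_15_36_44_all_of_clusterBHK3Pos`, `frontier_six_rows_of_clusterBHK3Pos`.
-/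

noncomputable section

namespace Summit.CriticalPhenomena.PercolationContinuityZ3.Theorems.FrontierDecRows

open MeasureTheory CovTransferCert E3GroupSepCert
open Literature.Probability.Percolation Literature.Probability.LatticeModels

variable {n : ℕ} (w : Sym2 (Fin n) → unitInterval)

/-- Rows 15, 36, 44 for all terminals from the named conjecture `ClusterBHK3Pos`. [this work] -/
theorem frontier_15_36_44_all_of_clusterBHK3Pos (hG : ClusterBHK3Pos) (a b c y : Fin n) :
    0 ≤ sahiE3 (prodBernoulli w) (connEvent (row 15 n (a, b, c, y)).1) (connEvent (row 15 n (a, b, c, y)).2.1)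
        (connEvent (row 15 n (a, b, c, y)).2.2) ∧
      0 ≤ sahiE3 (prodBernoulli w) (connEvent (row 36 n (a, b, c, y)).1) (connEvent (row 36 n (a, b, c, y)).2.1)
        (connEvent (row 36 n (a, b, c, y)).2.2) ∧
      0 ≤ sahiE3 (prodBernoulli w) (connEvent (row 44 n (a, b, c, y)).1) (connEvent (row 44 n (a, b, c, y)).2.1)
        (connEvent (row 44 n (a, b, c, y)).2.2) :=
  frontier_15_36_44_of_clusterBHK3 w (hG n w) a b c y

/-- **Six open dec rows from G⁺**: under `ClusterBHK3Pos`, rows 12, 15, 27, 30, 36, 44 of the four-point dec cubic frontier hold for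
every `n`, every weight function and all terminals `a b c y`. [this work] -/
theorem frontier_six_rows_of_clusterBHK3Pos (hG : ClusterBHK3Pos) (a b c y : Fin n) :
    0 ≤ sahiE3 (prodBernoulli w) (connEvent (row 12 n (a, b, c, y)).1) (connEvent (row 12 n (a, b, c, y)).2.1)
        (connEvent (row 12 n (a, b, c, y)).2.2) ∧
      0 ≤ sahiE3 (prodBernoulli w) (connEvent (row 15 n (a, b, c, y)).1) (connEvent (row 15 n (a, b, c, y)).2.1)
        (connEvent (row 15 n (a, b, c, y)).2.2) ∧
      0 ≤ sahiE3 (prodBernoulli w) (connEvent (row 27 n (a, b, c, y)).1) (connEvent (row 27 n (a, b, c, y)).2.1)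
        (connEvent (row 27 n (a, b, c, y)).2.2) ∧
      0 ≤ sahiE3 (prodBernoulli w) (connEvent (row 30 n (a, b, c, y)).1) (connEvent (row 30 n (a, b, c, y)).2.1)
        (connEvent (row 30 n (a, b, c, y)).2.2) ∧
      0 ≤ sahiE3 (prodBernoulli w) (connEvent (row 36 n (a, b, c, y)).1) (connEvent (row 36 n (a, b, c, y)).2.1)
        (connEvent (row 36 n (a, b, c, y)).2.2) ∧
      0 ≤ sahiE3 (prodBernoulli w) (connEvent (row 44 n (a, b, c, y)).1) (connEvent (row 44 n (a, b, c, y)).2.1)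
        (connEvent (row 44 n (a, b, c, y)).2.2) := by
  have h44 : ∀ a b c y : Fin n, 0 ≤ sahiE3 (prodBernoulli w) (connEvent (row 44 n (a, b, c, y)).1)
      (connEvent (row 44 n (a, b, c, y)).2.1) (connEvent (row 44 n (a, b, c, y)).2.2) :=
    fun a b c y => frontier_44_of_clusterBHK3 w (hG n w) a b c y
  obtain ⟨h12, h27, h30⟩ := frontier_12_27_30_all_of_frontier_44_all w h44 a b c y
  exact ⟨h12, frontier_15_of_clusterBHK3 w (hG n w) a b c y, h27, h30, frontier_36_of_clusterBHK3 w (hG n w) a b c y,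
    h44 a b c y⟩

end Summit.CriticalPhenomena.PercolationContinuityZ3.Theorems.FrontierDecRows
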